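import Mathlib
import Summits.NavierStokesRegularity.NavierStokesRegularity.Theorems.FilamentSkeletonRssStadiumDeviationPackage

/-!
# Route `FilamentSkeletonRss` · cruxes `SkeletonJ1L` (stmt-NavierStokesRegularity-23296, registered stub `stub_tangentSkeletonL` ≡
# `TangentSkeletonNearStraightL`, stmt-23320) · line `child_tangent_analytic_strip_L` (b0b56c52900dd90a), stub `stub_stripPropagation` —
# brick for the freeze step of `rcore`: THE REAL-AXIS END JUNCTIONS OF THE TENT ARE FEET DIFFERENCES

After the polygonal tube shift (`Theorems.StadiumPolygonalTubeShift.polygonal_tube_shift`) the tent of the anchor and the tent of a nearby target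
differ by the two END JUNCTIONS `[P 0, P' 0]`, `[P n, P' n]`, which lie ON THE REAL AXIS inside the parameter range of the stadium (feet at
`x₀ + hs/2` and `x + hs/2` on the right, at the foot of the long plateau on the left).  There the continued data are the real data
(`F σ = X σ`, `F′ σ = X′ σ`, `G σ = A σ` coordinatewise complexified), so a junction segment integral of the COMPLEX kernel is an interval integral
of the REAL-SOURCE kernel of the feet — and is absorbed by the corresponding foot (`∫_{x+hs/2}^{∞} = ∫_{x₀+hs/2}^{∞} − ∫_{x₀+hs/2}^{x+hs/2}`):
* `real_segment_eq_intervalIntegral` — `∫₀¹ (b − a) • g(a + t(b − a)) dt = ∫_a^b g(σ) dσ` for real `a, b` (affine substitution; any `g`);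
* `kernel_real_trace` — on the real trace the complex kernel IS the real-source kernel:
  `((Σᵢ (Fᵢ z − Fᵢ σ)² + κ G σ)^{3/2})⁻¹ • (F′ σ ⨯₃ (F z − F σ)) = ((Σᵢ (Fᵢ z − Xᵢ σ)² + κ A σ)^{3/2})⁻¹ • (X′ σ ⨯₃ (F z − X σ))`
  (`Theorems.StadiumDeviationPackage.deriv_real_point` for `F′ σ = X′ σ`);
* `real_junction_eq` — the two combined for a junction `[a, b]` inside the real trace.
HONEST FRAMING: a brick for the bookkeeping of a HYPOTHETICAL filament skeleton on the NEGATIVE side of a MODEL route; the stub `stub_stripPropagation`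
is NOT closed by this file, `TangentSkeletonNearStraightL` / `SkeletonJ1L` stay OPEN; nothing here bears on Navier–Stokes regularity or blow-up.
`--supports stmt-NavierStokesRegularity-23320` (≡ stub `stub_tangentSkeletonL` of 23296).
-/

set_option linter.dupNamespace false

noncomputable section

namespace Summit.NavierStokesRegularity.NavierStokesRegularity.Theorems.StadiumRealJunction

open Set MeasureTheory Complex
open scoped InnerProductSpace Matrix
open Summit.NavierStokesRegularity.NavierStokesRegularity.Theorems.StadiumDeviationPackage

/-- **Affine substitution for a real segment.**  For real `a, b` and any `g`: `∫₀¹ (b − a) • g(a + t(b − a)) dt = ∫_a^b g(σ) dσ`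
(segment integral in the normal form of `Theorems.StadiumSegmentTube`, complex scalar `(b : ℂ) − (a : ℂ)`). [folklore] -/
theorem real_segment_eq_intervalIntegral {E : Type*} [NormedAddCommGroup E] [NormedSpace ℝ E] [NormedSpace ℂ E]
    [IsScalarTower ℝ ℂ E] (g : ℂ → E) (a b : ℝ) :
    (∫ t in (0:ℝ)..1, ((b : ℂ) - (a : ℂ)) • g ((a : ℂ) + (t : ℂ) * ((b : ℂ) - (a : ℂ)))) = ∫ σ in a..b, g (σ : ℂ) := by
  have hsc : ∀ v : E, ((b : ℂ) - (a : ℂ)) • v = (b - a) • v := fun v => by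
    rw [show ((b : ℂ) - (a : ℂ)) = ((b - a : ℝ) : ℂ) by push_cast; ring, ← Complex.coe_algebraMap, algebraMap_smul]
  have harg : ∀ t : ℝ, (a : ℂ) + (t : ℂ) * ((b : ℂ) - (a : ℂ)) = (((b - a) * t + a : ℝ) : ℂ) := fun t => by
    push_cast; ring
  simp_rw [hsc, harg]
  rw [intervalIntegral.integral_smul, intervalIntegral.smul_integral_comp_mul_add (f := fun σ : ℝ => g (σ : ℂ))]
  simp

/-- **On the real trace the complex kernel is the real-source kernel.**  Stadium `S = {|Im| < hs, |Re − cc| < L + hs}`, `F` holomorphic on `S`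
with real trace `X` (differentiable), `G` with real trace `A`; for a real source `σ` with `|σ − cc| < L + hs` and any target `z`:
`((Σᵢ (Fᵢ z − Fᵢ σ)² + κ G σ)^{3/2})⁻¹ • (F′ σ ⨯₃ (F z − F σ)) = ((Σᵢ (Fᵢ z − Xᵢ σ)² + κ A σ)^{3/2})⁻¹ • (X′ σ ⨯₃ (F z − X σ))`. [folklore] -/
theorem kernel_real_trace {hs L cc : ℝ} {F : ℂ → (Fin 3 → ℂ)}
    (hF : DifferentiableOn ℂ F {z : ℂ | |z.im| < hs ∧ |z.re - cc| < L + hs})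
    {X : ℝ → EuclideanSpace ℝ (Fin 3)} (hX : Differentiable ℝ X)
    (hFX : ∀ r : ℝ, (r : ℂ) ∈ {z : ℂ | |z.im| < hs ∧ |z.re - cc| < L + hs} →
      F r = fun i => ((⟪X r, EuclideanSpace.single i (1:ℝ)⟫_ℝ : ℝ) : ℂ))
    {G : ℂ → ℂ} {A : ℝ → ℝ}
    (hGX : ∀ r : ℝ, (r : ℂ) ∈ {z : ℂ | |z.im| < hs ∧ |z.re - cc| < L + hs} → G r = ((A r : ℝ) : ℂ))
    (hhs : 0 < hs) (κ : ℝ) (z : ℂ) {σ : ℝ} (hσ : |σ - cc| < L + hs) :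
    (((∑ i, (F z i - F σ i) ^ 2) + (κ : ℂ) * G σ) ^ ((3:ℂ) / 2))⁻¹ • (deriv F σ ⨯₃ (fun i => F z i - F σ i)) =
      (((∑ i, (F z i - ((X σ i : ℝ) : ℂ)) ^ 2) + ((κ * A σ : ℝ) : ℂ)) ^ ((3:ℂ) / 2))⁻¹ •
        ((fun i => ((deriv X σ i : ℝ) : ℂ)) ⨯₃ (fun i => F z i - ((X σ i : ℝ) : ℂ))) := by
  have hσS : (σ : ℂ) ∈ {z : ℂ | |z.im| < hs ∧ |z.re - cc| < L + hs} := by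
    refine ⟨?_, ?_⟩
    · simpa using hhs
    · simpa using hσ
  have hF1 : F σ = fun i => ((X σ i : ℝ) : ℂ) := by
    rw [hFX σ hσS]
    funext i
    rw [inner_single_eq]
  have hF2 : deriv F σ = fun i => ((deriv X σ i : ℝ) : ℂ) := by
    funext i
    obtain ⟨hre, him⟩ := deriv_real_point hF hX hFX hhs hσ i
    apply Complex.ext
    · rw [hre, inner_single_eq, Complex.ofReal_re]
    · rw [him, Complex.ofReal_im]
  have hG1 : (κ : ℂ) * G σ = ((κ * A σ : ℝ) : ℂ) := by
    rw [hGX σ hσS]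
    push_cast
    ring
  rw [hF2, hG1, hF1]

/-- **A real junction of the tent is an interval integral of the foot kernel.**  Under the hypotheses of `kernel_real_trace`, for real `a, b` with
`[a, b]` (unordered) inside the real trace `|σ − cc| < L + hs`, the junction segment integral of the complex kernel equals the interval integral of
the real-source kernel: `[a, b]_z = ∫_a^b ((Σᵢ (Fᵢ z − Xᵢ σ)² + κ A σ)^{3/2})⁻¹ • (X′ σ ⨯₃ (F z − X σ)) dσ`. [folklore] -/
theorem real_junction_eq {hs L cc : ℝ} {F : ℂ → (Fin 3 → ℂ)}
    (hF : DifferentiableOn ℂ F {z : ℂ | |z.im| < hs ∧ |z.re - cc| < L + hs})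
    {X : ℝ → EuclideanSpace ℝ (Fin 3)} (hX : Differentiable ℝ X)
    (hFX : ∀ r : ℝ, (r : ℂ) ∈ {z : ℂ | |z.im| < hs ∧ |z.re - cc| < L + hs} →
      F r = fun i => ((⟪X r, EuclideanSpace.single i (1:ℝ)⟫_ℝ : ℝ) : ℂ))
    {G : ℂ → ℂ} {A : ℝ → ℝ}
    (hGX : ∀ r : ℝ, (r : ℂ) ∈ {z : ℂ | |z.im| < hs ∧ |z.re - cc| < L + hs} → G r = ((A r : ℝ) : ℂ))
    (hhs : 0 < hs) (κ : ℝ) (z : ℂ) {a b : ℝ} (hab : ∀ σ ∈ uIcc a b, |σ - cc| < L + hs) :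
    (∫ t in (0:ℝ)..1, ((b : ℂ) - (a : ℂ)) •
        ((((∑ i, (F z i - F ((a : ℂ) + (t : ℂ) * ((b : ℂ) - (a : ℂ))) i) ^ 2) +
            (κ : ℂ) * G ((a : ℂ) + (t : ℂ) * ((b : ℂ) - (a : ℂ)))) ^ ((3:ℂ) / 2))⁻¹ •
          (deriv F ((a : ℂ) + (t : ℂ) * ((b : ℂ) - (a : ℂ))) ⨯₃
            (fun i => F z i - F ((a : ℂ) + (t : ℂ) * ((b : ℂ) - (a : ℂ))) i)))) =
      ∫ σ in a..b, (((∑ i, (F z i - ((X σ i : ℝ) : ℂ)) ^ 2) + ((κ * A σ : ℝ) : ℂ)) ^ ((3:ℂ) / 2))⁻¹ •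
        ((fun i => ((deriv X σ i : ℝ) : ℂ)) ⨯₃ (fun i => F z i - ((X σ i : ℝ) : ℂ))) := by
  rw [real_segment_eq_intervalIntegral
    (g := fun ζ => (((∑ i, (F z i - F ζ i) ^ 2) + (κ : ℂ) * G ζ) ^ ((3:ℂ) / 2))⁻¹ • (deriv F ζ ⨯₃ (fun i => F z i - F ζ i))) a b]
  refine intervalIntegral.integral_congr fun σ hσ => ?_
  exact kernel_real_trace hF hX hFX hGX hhs κ z (hab σ hσ)

end Summit.NavierStokesRegularity.NavierStokesRegularity.Theorems.StadiumRealJunction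

end
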